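import Literature.Barriers.ValiantsHypothesis.PlethysmListCodeMachine
import Literature.Barriers.ValiantsHypothesis.KroneckerXRayMachine
import HarnessLib

/-!
# From list codes `⟨n, λ⟩` to the barrier's plethysm codes `⟨λᵀ, n⟩`: the transposition machine
# (Fischer–Ikenmeyer 2020, Lemma 4: "`(λᵀ, n)` is returned", in `FP`)

N. Fischer, C. Ikenmeyer, *The computational complexity of plethysm coefficients*, Comput.
Complexity 29 (2020) 8, Lemma 4 (proof, last sentence): "The same argument works for `a_λ(n, 3)` and
`β(|λ|/3)`. Here, in the nontrivial case, `(λᵀ, n)` is returned." In the word model the plethysm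
coefficient `a_λ(n,m)` is the dimension of the `s`-isotypic highest-weight space of weight `λᵀ`
(`PlethysmWordModel.lean`, FI Fact 1), so the last arrow of the reduction chain
(`PlethysmHardness.lean`) sends the list code of `(n, μ)` (`encodingComposition` on `n :: μ.sortedParts`,
`PlethysmListCodeMachine.lean`) to the code `encodePartition μᵀ ++ unaryNat n` of the barrier file
`KroneckerPositivityHardness.lean`. This file builds that map by brick algebra:

* tests on a list code `w = encode (n :: L)`: `noZeroT` (no zero entry in `L`), `sumEqT m`
  (`|L| = m·n`, comparing `1^{|L|}` with `m` copies of `1ⁿ`), and the conjunction `validT m` (with the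
  code test `isCanonFn`, the header test and the antitone test of `PlethysmCodeMachine.lean`) — true iff
  `L` is the sorted parts of a partition of `n·m`;
* `trCodeF`: on `encode L`, the unary blocks `1^{c_j} 0`, `j < L₀`, with `c_j = #{i : j < L_i}` — the
  column lengths of the Young diagram of `L`, i.e. the parts of the transpose
  (`rowCounts`, `sortedParts_transpose_partitionOfRows` of `KroneckerXRayCodes.lean`) — by a
  concatenation fold of counting folds (the pattern of `KroneckerXRayMachine.lean`);
* **`transOutF m`** `= iteFn (validT m) (trCodeF ∘ tailF ++ 0 ++ item₀ ++ 0) ε` and its value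
  `transOutF_encode_cons`: `unaryList (rowCounts L) ++ unaryNat n` on valid inputs, the empty word
  otherwise.

## References

* [FischerIkenmeyer2020] §6, Lemma 4 (proof); §4 (Lemma 1: polynomial time); §3 (unary encodings).
* [IkenmeyerMulmuleyWalter2017] §1.1 (partitions in unary).
* [AroraBarak2009] §1.3.
-/

noncomputable section

namespace Literature.Barriers.ValiantsHypothesis

open Literature.Computability.Complexity Literature.Computability.Complexity.Tomography
open _root_.Computability Polynomial Brick HashBricks CanonCode Plumb OracleCompose

namespace PlethCode

/-! ### Tests -/

/-- **`noZeroT x = [no entry of L is 0]`** (a count fold of the empty-item indicators). [folklore] -/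
def noZeroT : List Bool → List Bool := isNilFn ∘ foldW 1 (oneIf (isNilFn ∘ itemW))

/-- `noZeroT ∈ FP`. [folklore] -/
theorem noZeroT_mem_FP : noZeroT ∈ FP :=
  comp_mem_FP isNilFn_mem_FP (foldW_mem_FP (oneIf_mem_FP (comp_mem_FP isNilFn_mem_FP itemW_mem_FP)))

/-- `noZeroT` is one-bit. [folklore] -/
theorem oneBit_noZeroT : OneBit noZeroT := oneBit_isNilFn.comp _

/-- The empty-item indicator of item `j`. [folklore] -/
theorem isNil_itemW_apply (l : List ℕ) (j : ℕ) :
    (isNilFn ∘ itemW) (boolPair (wOf l) (ones j)) = [decide (listFn l j = 0)] := by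
  rw [Function.comp_apply, itemW_apply]
  change [decide (ones _ = [])] = _
  simp [ones, List.replicate_eq_nil_iff]

/-- Value of `noZeroT` on a code. [folklore] -/
theorem noZeroT_wOf (l : List ℕ) : noZeroT (wOf l) = [decide (∀ j < l.length, listFn l j ≠ 0)] := by
  rw [noZeroT, Function.comp_apply, foldW_wOf l]
  · rw [show (fun j => oneIf (isNilFn ∘ itemW) (boolPair (wOf l) (ones j))) =
        fun j => ones (decide (listFn l j = 0)).toNat from funext fun j => oneIf_apply (isNil_itemW_apply l j),
      Tomography.ccat_ones]
    change [decide (ones _ = [])] = _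
    congr 1
    simp only [ones, List.replicate_eq_nil_iff, Finset.sum_eq_zero_iff, Finset.mem_range, decide_eq_decide]
    refine forall₂_congr fun j _ => ?_
    rw [Bool.toNat_eq_zero, decide_eq_false_iff_not]
  · intro j _
    rw [oneIf_apply (isNil_itemW_apply l j), List.length_replicate]
    have := Bool.toNat_le (decide (listFn l j = 0))
    omega

/-- `1ᵘ ↦ (1ᵘ)^m` (`m` copies). [folklore] -/
def repF : ℕ → (List Bool → List Bool)
  | 0 => fun _ => []
  | m + 1 => fun u => repF m u ++ u

/-- `repF m ∈ FP`. [folklore] -/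
theorem repF_mem_FP : ∀ m : ℕ, repF m ∈ FP
  | 0 => const_mem_FP _
  | m + 1 => append_mem_FP (repF_mem_FP m) id_mem_FP

/-- `repF m (1ⁿ) = 1^{m n}`. [folklore] -/
theorem repF_ones : ∀ m n : ℕ, repF m (ones n) = ones (m * n)
  | 0, n => by simp [repF, ones]
  | m + 1, n => by
    show repF m (ones n) ++ ones n = _
    rw [repF_ones m n, Nat.succ_mul]
    exact List.replicate_append_replicate ..

/-- **`sumEqT m w = [|L| = m·n]`** on `w = encode (n :: L)`. [folklore] -/
def sumEqT (m : ℕ) : List Bool → List Bool := eqPairFn ∘ fanoutFn (usumF ∘ tailF) (repF m ∘ item0F)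

/-- `sumEqT m ∈ FP`. [folklore] -/
theorem sumEqT_mem_FP (m : ℕ) : sumEqT m ∈ FP :=
  comp_mem_FP eqPairFn_mem_FP (fanoutFn_mem_FP (comp_mem_FP usumF_mem_FP tailF_mem_FP)
    (comp_mem_FP (repF_mem_FP m) item0F_mem_FP))

/-- `sumEqT m` is one-bit. [folklore] -/
theorem oneBit_sumEqT (m : ℕ) : OneBit (sumEqT m) := oneBit_eqPairFn.comp _

/-- Value of `sumEqT m` on the code of `n :: L`. [folklore] -/
theorem sumEqT_wOf_cons (m n : ℕ) (L : List ℕ) : sumEqT m (wOf (n :: L)) = [decide (L.sum = m * n)] := by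
  rw [sumEqT, Function.comp_apply, fanoutFn_apply, Function.comp_apply, Function.comp_apply, tailF_wOf_cons,
    usumF_wOf, item0F_wOf, eqPairFn_boolPair]
  have h0 : listFn (n :: L) 0 = n := rfl
  rw [h0, repF_ones]
  have : (ones L.sum = ones (m * n)) ↔ L.sum = m * n := by rw [ones, ones, List.replicate_left_inj]
  simp only [this]

/-- **The validity test**: canonical code of `n :: L` with `L` weakly decreasing, without zeros, of sum
`m·n` — i.e. `L` is the sorted parts of a partition of `n·m`. [cite: FischerIkenmeyer2020, Lemma 4 (proof)] -/
def validT (m : ℕ) : List Bool → List Bool :=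
  andFn isCanonFn (andFn hdrT (andFn (antiT ∘ tailF) (andFn (noZeroT ∘ tailF) (sumEqT m))))

/-- `validT m ∈ FP`. [folklore] -/
theorem validT_mem_FP (m : ℕ) : validT m ∈ FP :=
  andFn_mem_FP isCanonFn_mem_FP (andFn_mem_FP hdrT_mem_FP (andFn_mem_FP (comp_mem_FP antiT_mem_FP tailF_mem_FP)
    (andFn_mem_FP (comp_mem_FP noZeroT_mem_FP tailF_mem_FP) (sumEqT_mem_FP m))))

/-- The antitone test is one-bit. [folklore] -/
theorem oneBit_antiT : OneBit antiT := oneBit_isNilFn.comp _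

/-- The condition tested by `validT m` on the list `n :: L`. [folklore] -/
def ValidL (m n : ℕ) (L : List ℕ) : Prop := AntiL L ∧ (∀ j < L.length, listFn L j ≠ 0) ∧ L.sum = m * n

/-- `ValidL` is decidable. [folklore] -/
instance (m n : ℕ) (L : List ℕ) : Decidable (ValidL m n L) := inferInstanceAs (Decidable (_ ∧ _ ∧ _))

/-- Value of `validT m` on the code of `n :: L`. [folklore] -/
theorem validT_wOf_cons (m n : ℕ) (L : List ℕ) : validT m (wOf (n :: L)) = [decide (ValidL m n L)] := by
  have hc : isCanonFn (wOf (n :: L)) = [true] := by rw [isCanonFn_apply, wOf, decComp_encode]; simp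
  have hh : hdrT (wOf (n :: L)) = [true] := by rw [hdrT_wOf]; simp
  have ha : (antiT ∘ tailF) (wOf (n :: L)) = [decide (AntiL L)] := by
    rw [Function.comp_apply, tailF_wOf_cons, antiT_wOf]
  have hz : (noZeroT ∘ tailF) (wOf (n :: L)) = [decide (∀ j < L.length, listFn L j ≠ 0)] := by
    rw [Function.comp_apply, tailF_wOf_cons, noZeroT_wOf]
  rw [validT, andFn_apply hc (andFn_apply hh (andFn_apply ha (andFn_apply hz (sumEqT_wOf_cons m n L)))),
    Bool.true_and, Bool.true_and]
  by_cases h1 : AntiL L <;> by_cases h2 : (∀ j < L.length, listFn L j ≠ 0) <;> by_cases h3 : L.sum = m * n <;>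
    simp [ValidL, h1, h2, h3]

/-- Value of `validT m` on the code of the empty list: `false` (header empty). [folklore] -/
theorem validT_wOf_nil (m : ℕ) : validT m (wOf ([] : List ℕ)) = [false] := by
  have hc : isCanonFn (wOf ([] : List ℕ)) = [true] := by rw [isCanonFn_apply, wOf, decComp_encode]; simp
  have hh : hdrT (wOf ([] : List ℕ)) = [false] := by rw [hdrT_wOf]; simp
  obtain ⟨b1, hb1⟩ := (oneBit_antiT.comp tailF) (wOf ([] : List ℕ))
  obtain ⟨b2, hb2⟩ := (oneBit_noZeroT.comp tailF) (wOf ([] : List ℕ))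
  obtain ⟨b3, hb3⟩ := oneBit_sumEqT m (wOf ([] : List ℕ))
  rw [validT, andFn_apply hc (andFn_apply hh (andFn_apply hb1 (andFn_apply hb2 hb3)))]
  simp

/-- Value of `validT m` on a non-code: `false`. [folklore] -/
theorem validT_of_not_canon (m : ℕ) {w : List Bool} (hw : encodingComposition.encode (decComp w) ≠ w) :
    validT m w = [false] := by
  have hc : isCanonFn w = [false] := by rw [isCanonFn_apply]; simp [hw]
  obtain ⟨b0, hb0⟩ := oneBit_hdrT w
  obtain ⟨b1, hb1⟩ := (oneBit_antiT.comp tailF) w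
  obtain ⟨b2, hb2⟩ := (oneBit_noZeroT.comp tailF) w
  obtain ⟨b3, hb3⟩ := oneBit_sumEqT m w
  rw [validT, andFn_apply hc (andFn_apply hb0 (andFn_apply hb1 (andFn_apply hb2 hb3)))]
  simp

/-! ### The transpose in unary: column lengths by counting folds -/

/-- The bit `1^{[j < L_i]}` at `⟨⟨x, 1ʲ⟩, 1ⁱ⟩`, `x = encode L`. [cite: IkenmeyerMulmuleyWalter2017, §1.1 (λᵀ)] -/
def bitPieceT : List Bool → List Bool :=
  oneIf (ltLenF ∘ fanoutFn (sndF ∘ fstF) (nthItemFn ∘ fanoutFn sndF (sndF ∘ fstF ∘ fstF)))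

/-- `bitPieceT ∈ FP`. [folklore] -/
theorem bitPieceT_mem_FP : bitPieceT ∈ FP :=
  oneIf_mem_FP (comp_mem_FP ltLenF_mem_FP (fanoutFn_mem_FP (comp_mem_FP sndF_mem_FP fstF_mem_FP)
    (comp_mem_FP nthItemFn_mem_FP (fanoutFn_mem_FP sndF_mem_FP
      (comp_mem_FP sndF_mem_FP (comp_mem_FP fstF_mem_FP fstF_mem_FP))))))

/-- Value of the bit. [folklore] -/
theorem bitPieceT_apply (L : List ℕ) (j i : ℕ) :
    bitPieceT (boolPair (boolPair (wOf L) (ones j)) (ones i)) = ones (decide (j < listFn L i)).toNat := by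
  rw [bitPieceT, oneIf_apply]
  rw [Function.comp_apply, fanoutFn_apply, Function.comp_apply, Function.comp_apply, fanoutFn_apply,
    Function.comp_apply, Function.comp_apply, fstF_boolPair, sndF_boolPair, sndF_boolPair, fstF_boolPair]
  have hit : nthItemFn (boolPair (ones i) (sndF (wOf L))) = ones (listFn L i) := by
    rw [wOf, encode_eq_boolPair_body, sndF_boolPair]
    exact nthItemFn_ones_body_map L i
  rw [hit, ltLenF_boolPair, List.length_replicate, List.length_replicate]

/-- **The count `c_j = #{i < |L| : j < L_i}`** in unary, by a fold over the items (context `⟨x, 1ʲ⟩`).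
[cite: AroraBarak2009, §1.3 (bounded loops)] -/
def innerCountF : List Bool → List Bool := sndPow 2 ∘ foldLoop appF (clipF 1 bitPieceT) X ∘ initF (fstF ∘ fstF)

/-- `innerCountF ∈ FP`. [folklore] -/
theorem innerCountF_mem_FP : innerCountF ∈ FP :=
  comp_mem_FP (sndPow_mem_FP 2) (comp_mem_FP (foldLoop_clipF_mem_FP 1 appF_mem_FP length_appF_le bitPieceT_mem_FP X)
    (initF_mem_FP (comp_mem_FP fstF_mem_FP fstF_mem_FP)))

/-- The count `c_j`. [cite: IkenmeyerMulmuleyWalter2017, §1.1 (λᵀ)] -/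
def cntT (L : List ℕ) (j : ℕ) : ℕ := ((Finset.range L.length).filter fun i => j < listFn L i).card

/-- Value of `innerCountF` at `⟨encode L, 1ʲ⟩`. [folklore] -/
theorem innerCountF_apply (L : List ℕ) (j : ℕ) : innerCountF (boolPair (wOf L) (ones j)) = ones (cntT L j) := by
  have hk : L.length ≤ (X : Polynomial ℕ).eval (boolPair (wOf L) (ones j)).length := by
    rw [eval_X, length_boolPair]
    have := length_le_length_wOf L
    omega
  rw [innerCountF, Function.comp_apply, Function.comp_apply, initF_apply, Function.comp_apply, fstF_boolPair,
    fstF_wOf, List.length_replicate, foldLoop_apply _ _ hk, sndPow_succ_boolPair, sndPow_succ_boolPair,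
    sndPow_zero_boolPair, foldAcc_clipF, foldAcc_appF, List.nil_append]
  · rw [show (fun i => bitPieceT (boolPair (boolPair (wOf L) (ones j)) (ones (0 + i)))) =
        fun i => ones (decide (j < listFn L i)).toNat from funext fun i => by rw [Nat.zero_add, bitPieceT_apply],
      Tomography.ccat_ones, cntT, Finset.card_filter]
    congr 1
    refine Finset.sum_congr rfl fun i _ => ?_
    by_cases h : j < listFn L i <;> simp [h]
  · intro i _ _
    rw [bitPieceT_apply, List.length_replicate, length_boolPair]
    have := Bool.toNat_le (decide (j < listFn L i))
    omega

/-- The block `1^{c_j} 0`. [folklore] -/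
def blockPieceT : List Bool → List Bool := fun z => innerCountF z ++ [false]

/-- `blockPieceT ∈ FP`. [folklore] -/
theorem blockPieceT_mem_FP : blockPieceT ∈ FP := append_mem_FP innerCountF_mem_FP (const_mem_FP _)

/-- `c_j ≤ |L|`. [folklore] -/
theorem cntT_le (L : List ℕ) (j : ℕ) : cntT L j ≤ L.length := by
  unfold cntT
  exact (Finset.card_filter_le _ _).trans (by simp)

/-- The initial record of the block fold: `⟨x, ⟨⌜L₀⌝, ⟨1⁰, ε⟩⟩⟩` (`L₀` rounds). [folklore] -/
def initOT : List Bool → List Bool := fanoutFn id (fanoutFn (lenBinF ∘ item0F) fun _ => boolPair (ones 0) [])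

/-- `initOT ∈ FP`. [folklore] -/
theorem initOT_mem_FP : initOT ∈ FP :=
  fanoutFn_mem_FP id_mem_FP (fanoutFn_mem_FP (comp_mem_FP lenBinF_mem_FP item0F_mem_FP) (const_mem_FP _))

/-- **The transpose code**: the blocks `1^{c_j} 0`, `j < L₀`, concatenated.
[cite: IkenmeyerMulmuleyWalter2017, §1.1 (unary codes; λᵀ)] -/
def trCodeF : List Bool → List Bool := sndPow 2 ∘ foldLoop appF (clipF 1 blockPieceT) X ∘ initOT

/-- `trCodeF ∈ FP`. [cite: AroraBarak2009, §1.3] -/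
theorem trCodeF_mem_FP : trCodeF ∈ FP :=
  comp_mem_FP (sndPow_mem_FP 2) (comp_mem_FP (foldLoop_clipF_mem_FP 1 appF_mem_FP length_appF_le blockPieceT_mem_FP X)
    initOT_mem_FP)

/-- **Value of `trCodeF` on `encode L`**: `unaryList (rowCounts L)` without its terminating `0`. [folklore] -/
theorem trCodeF_wOf (L : List ℕ) :
    trCodeF (wOf L) ++ [false] = unaryList (rowCounts (listFn L) L.length) := by
  have hk : listFn L 0 ≤ (X : Polynomial ℕ).eval (wOf L).length := by
    rw [eval_X]
    exact (listFn_le_sum L 0).trans (sum_le_length_wOf L)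
  have hinit : initOT (wOf L) = boolPair (wOf L) (boolPair (encodeNat (listFn L 0)) (boolPair (ones 0) [])) := by
    simp [initOT, item0F_wOf, lenBinF_apply]
  rw [trCodeF, Function.comp_apply, Function.comp_apply, hinit, foldLoop_apply _ _ hk, sndPow_succ_boolPair,
    sndPow_succ_boolPair, sndPow_zero_boolPair, foldAcc_clipF, foldAcc_appF, List.nil_append]
  · rw [show (fun j => blockPieceT (boolPair (wOf L) (ones (0 + j)))) = fun j => ones (cntT L j) ++ [false] from
        funext fun j => by rw [Nat.zero_add, blockPieceT, innerCountF_apply],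
      XRayKron.ccat_blocks, unaryList, rowCounts]
    rfl
  · intro j _ _
    rw [blockPieceT, List.length_append, innerCountF_apply, List.length_replicate, List.length_singleton]
    have := cntT_le L j
    have := length_le_length_wOf L
    omega

/-! ### The machine -/

/-- The suffix `1ⁿ 0 = unaryNat n`. [folklore] -/
def sfxF : List Bool → List Bool := fun w => item0F w ++ [false]

/-- `sfxF ∈ FP`. [folklore] -/
theorem sfxF_mem_FP : sfxF ∈ FP := append_mem_FP item0F_mem_FP (const_mem_FP _)

/-- The transpose blocks of the tail. [folklore] -/
def trTailF : List Bool → List Bool := trCodeF ∘ tailF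

/-- `trTailF ∈ FP`. [folklore] -/
theorem trTailF_mem_FP : trTailF ∈ FP := comp_mem_FP trCodeF_mem_FP tailF_mem_FP

/-- The transpose blocks with their terminator. [folklore] -/
def trCode0F : List Bool → List Bool := fun w => trTailF w ++ [false]

/-- `trCode0F ∈ FP`. [folklore] -/
theorem trCode0F_mem_FP : trCode0F ∈ FP := append_mem_FP trTailF_mem_FP (const_mem_FP _)

/-- The output assembly: transpose blocks, terminator, `1ⁿ 0`. [folklore] -/
def outTF : List Bool → List Bool := fun w => trCode0F w ++ sfxF w

/-- `outTF ∈ FP`. [folklore] -/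
theorem outTF_mem_FP : outTF ∈ FP := append_mem_FP trCode0F_mem_FP sfxF_mem_FP

/-- Value of the output assembly on the code of `n :: L`. [folklore] -/
theorem outTF_wOf_cons (n : ℕ) (L : List ℕ) :
    outTF (wOf (n :: L)) = unaryList (rowCounts (listFn L) L.length) ++ unaryNat n := by
  rw [outTF, trCode0F, sfxF, trTailF, Function.comp_apply, tailF_wOf_cons, item0F_wOf, trCodeF_wOf, unaryNat]
  rfl

/-- **The transposition machine `transOutF m`**: on a valid list code of `(n, L)`, the barrier code
`unaryList (rowCounts L) ++ unaryNat n` of `(Lᵀ, n)`; the empty word otherwise.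
[cite: FischerIkenmeyer2020, Lemma 4 (proof: "(λᵀ, n) is returned")] -/
def transOutF (m : ℕ) : List Bool → List Bool := iteFn (validT m) outTF fun _ => []

/-- **`transOutF m ∈ FP`**. [cite: AroraBarak2009, §1.3] -/
theorem transOutF_mem_FP (m : ℕ) : transOutF m ∈ FP := iteFn_mem_FP (validT_mem_FP m) outTF_mem_FP (const_mem_FP _)

/-- **Value on the code of `n :: L`.** [cite: FischerIkenmeyer2020, Lemma 4 (proof)] -/
theorem transOutF_encode_cons (m n : ℕ) (L : List ℕ) :
    transOutF m (encodingComposition.encode (n :: L)) =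
      if ValidL m n L then unaryList (rowCounts (listFn L) L.length) ++ unaryNat n else [] := by
  change transOutF m (wOf (n :: L)) = _
  rw [transOutF, iteFn_apply (validT_wOf_cons m n L)]
  by_cases h : ValidL m n L
  · rw [decide_eq_true h, if_pos rfl, if_pos h, outTF_wOf_cons]
  · rw [decide_eq_false h, if_neg (by decide), if_neg h]

/-- Value on the code of the empty list. [folklore] -/
theorem transOutF_encode_nil (m : ℕ) : transOutF m (encodingComposition.encode ([] : List ℕ)) = [] := by
  change transOutF m (wOf []) = _
  rw [transOutF, iteFn_apply (validT_wOf_nil m)]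
  simp

/-- Value on a non-code. [folklore] -/
theorem transOutF_of_not_canon (m : ℕ) {w : List Bool} (hw : encodingComposition.encode (decComp w) ≠ w) :
    transOutF m w = [] := by
  rw [transOutF, iteFn_apply (validT_of_not_canon m hw)]
  simp

/-! ### The transpose as a LIST code (for the closed-cone base of the chain) -/

/-- The item `⟨1^{c_j}, ε⟩` of the transpose, at `⟨encode L, 1ʲ⟩`. [folklore] -/
def trItemPiece : List Bool → List Bool := fanoutFn innerCountF fun _ => []

/-- `trItemPiece ∈ FP`. [folklore] -/
theorem trItemPiece_mem_FP : trItemPiece ∈ FP := fanoutFn_mem_FP innerCountF_mem_FP (const_mem_FP _)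

/-- **The items of the transpose**: `⟨1^{c_j}, ε⟩`, `j < L₀`, concatenated. [cite: IkenmeyerMulmuleyWalter2017, §1.1 (λᵀ)] -/
def trItemsF : List Bool → List Bool := sndPow 2 ∘ foldLoop appF (clipF 2 trItemPiece) X ∘ initOT

/-- `trItemsF ∈ FP`. [cite: AroraBarak2009, §1.3] -/
theorem trItemsF_mem_FP : trItemsF ∈ FP :=
  comp_mem_FP (sndPow_mem_FP 2) (comp_mem_FP (foldLoop_clipF_mem_FP 2 appF_mem_FP length_appF_le trItemPiece_mem_FP X)
    initOT_mem_FP)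

/-- Entries of `rowCounts`. [folklore] -/
theorem listFn_rowCounts (L : List ℕ) (j : ℕ) :
    listFn (rowCounts (listFn L) L.length) j = if j < listFn L 0 then cntT L j else 0 := by
  by_cases hj : j < listFn L 0
  · rw [if_pos hj, listFn_of_lt (by rw [length_rowCounts]; exact hj)]
    simp [rowCounts, cntT]
  · rw [if_neg hj, listFn_of_le (by rw [length_rowCounts]; omega)]

/-- **Value of `trItemsF` on `encode L`**: the items part of `encode (rowCounts L)`. [folklore] -/
theorem trItemsF_wOf (L : List ℕ) :
    trItemsF (wOf L) = ccat (fun j => boolPair (ones (listFn (rowCounts (listFn L) L.length) j)) [])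
      (rowCounts (listFn L) L.length).length := by
  have hk : listFn L 0 ≤ (X : Polynomial ℕ).eval (wOf L).length := by
    rw [eval_X]
    exact (listFn_le_sum L 0).trans (sum_le_length_wOf L)
  have hinit : initOT (wOf L) = boolPair (wOf L) (boolPair (encodeNat (listFn L 0)) (boolPair (ones 0) [])) := by
    simp [initOT, item0F_wOf, lenBinF_apply]
  rw [trItemsF, Function.comp_apply, Function.comp_apply, hinit, foldLoop_apply _ _ hk, sndPow_succ_boolPair,
    sndPow_succ_boolPair, sndPow_zero_boolPair, foldAcc_clipF, foldAcc_appF, List.nil_append, length_rowCounts]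
  · refine ccat_congr fun j hj => ?_
    rw [Nat.zero_add, trItemPiece, fanoutFn_apply, innerCountF_apply, listFn_rowCounts, if_pos hj]
  · intro j _ _
    rw [trItemPiece, fanoutFn_apply, innerCountF_apply, length_boolPair, List.length_replicate, List.length_nil]
    have := cntT_le L j
    have := length_le_length_wOf L
    omega

/-- The first item of the tail, plus one: the header `1^{L₀ + 1}` of the transpose list code. [folklore] -/
def trHdrF : List Bool → List Bool := List.cons true ∘ item0F ∘ tailF

/-- `trHdrF ∈ FP`. [folklore] -/
theorem trHdrF_mem_FP : trHdrF ∈ FP := comp_mem_FP (cons_mem_FP true) (comp_mem_FP item0F_mem_FP tailF_mem_FP)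

/-- The items of the transpose of the tail. [folklore] -/
def trTailItemsF : List Bool → List Bool := trItemsF ∘ tailF

/-- `trTailItemsF ∈ FP`. [folklore] -/
theorem trTailItemsF_mem_FP : trTailItemsF ∈ FP := comp_mem_FP trItemsF_mem_FP tailF_mem_FP

/-- **The list-level transpose `trLF`**: the list code of `(n, L)` ↦ the list code of `(n, rowCounts L)`.
[cite: FischerIkenmeyer2020, Lemma 4 (proof: "(λᵀ, n) is returned")] -/
def trLF : List Bool → List Bool := fanoutFn trHdrF (fanoutFn item0F trTailItemsF)

/-- `trLF ∈ FP`. [cite: AroraBarak2009, §1.3] -/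
theorem trLF_mem_FP : trLF ∈ FP := fanoutFn_mem_FP trHdrF_mem_FP (fanoutFn_mem_FP item0F_mem_FP trTailItemsF_mem_FP)

/-- **Value of `trLF` on the code of `n :: L`.** [folklore] -/
theorem trLF_wOf_cons (n : ℕ) (L : List ℕ) :
    trLF (wOf (n :: L)) = wOf (n :: rowCounts (listFn L) L.length) := by
  rw [trLF, fanoutFn_apply, fanoutFn_apply, trHdrF, trTailItemsF, Function.comp_apply, Function.comp_apply,
    Function.comp_apply, tailF_wOf_cons, item0F_wOf, item0F_wOf, trItemsF_wOf]
  conv_rhs => rw [wOf, encode_eq_boolPair_body, List.map_cons, body_cons, body_map_ones_eq_ccat, List.length_cons,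
    length_rowCounts]
  have h0 : listFn (n :: L) 0 = n := rfl
  rw [h0, length_rowCounts]
  rfl

/-- **The entry conversion with transposition `convLTF`**: on the code of a weakly decreasing composition
`λ` with `3 ∣ |λ|`, the list code of `(|λ|/3, (λ without zeros)ᵀ)`; otherwise `badL` (the closed-cone
entry of the chain: `b_λ(n,3)` is the `σₒ`-multiplicity of `λ`, i.e. the `s·σₒ`-multiplicity of `λᵀ`).
[cite: FischerIkenmeyer2020, Lemma 4 (proof) with Fact 1] -/
def convLTF : List Bool → List Bool := iteFn (andFn div3T antiT) (trLF ∘ outLF) fun _ => badL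

/-- **`convLTF ∈ FP`**. [cite: AroraBarak2009, §1.3] -/
theorem convLTF_mem_FP : convLTF ∈ FP :=
  iteFn_mem_FP (andFn_mem_FP div3T_mem_FP antiT_mem_FP) (comp_mem_FP trLF_mem_FP outLF_mem_FP) (const_mem_FP _)

/-- **Value of `convLTF` on a composition code.** [cite: FischerIkenmeyer2020, Lemma 4 (proof)] -/
theorem convLTF_encode (l : List ℕ) :
    convLTF (encodingComposition.encode l) =
      if 3 ∣ l.sum ∧ AntiL l then
        encodingComposition.encode (l.sum / 3 :: rowCounts (listFn (l.filter (· ≠ 0))) (l.filter (· ≠ 0)).length)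
      else badL := by
  change convLTF (wOf l) = _
  rw [convLTF, iteFn_apply (andFn_apply (div3T_wOf l) (antiT_wOf l))]
  by_cases h3 : 3 ∣ l.sum
  · by_cases ha : AntiL l
    · rw [decide_eq_true h3, decide_eq_true ha, Bool.true_and, if_pos rfl, if_pos ⟨h3, ha⟩, Function.comp_apply,
        outLF_wOf h3]
      exact trLF_wOf_cons _ _
    · rw [decide_eq_false ha, Bool.and_false, if_neg (by decide), if_neg (fun h => ha h.2)]
  · rw [decide_eq_false h3, Bool.false_and, if_neg (by decide), if_neg (fun h => h3 h.1)]

end PlethCode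

end Literature.Barriers.ValiantsHypothesis
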